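import Literature.Barriers.CriticalPhenomena.TimarLemma53Targets
import Literature.Barriers.CriticalPhenomena.TimarHeavySlabsQuasiTransitiveW
import Literature.Barriers.CriticalPhenomena.TimarOnePartitionQuasiTransitive
import Literature.Barriers.CriticalPhenomena.TimarMassTransportQuasiTransitive
import HarnessLib

/-!
# Timár 2006, Lemma 5.3 (second part) on QUASI-TRANSITIVE graphs: every heavy branch at an
# encounter point contains an encounter point of the class of the 1-partition — PROVED

Barrier catalogue `Literature/Barriers/CriticalPhenomena/`; the quasi-transitive twin of
`TimarLemma53Targets.lean` (TRANSITIVE graphs), run on the quasi-transitive 1-partition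
`OnePartitionRelQ` (`TimarOnePartitionQuasiTransitive.lean`, classes `weightSlab G o (δ b) b` with
the extreme edge ratio `δ`). Á. Timár, *Percolation on nonunimodular transitive graphs*, Ann.
Probab. 34 (2006) 2344–2364, §5, p. 2357:

> **Lemma 5.3.** … let `L₀` be a class of the 1-partition of `G` and suppose that `L₀ ∩ ω`
> contains some encounter point. Then for any encounter point `x ∈ L₀ ∩ ω` and any open heavy
> component `C` in `ω ∖ {x}` that is adjacent to `x` in `ω`, `C ∩ L₀` contains some vertex that is
> an encounter point for `ω`. *Proof.* … let each vertex `y` contained in such a `C ∩ L₀` send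
> mass `1` to `x` … Since `C ∩ L₀` is infinite (by deletion tolerance and Lemma 5.2), the expected
> mass received is infinite. The expected mass sent out is at most `1`. This MTP contradiction
> proves the second part of the claimed assertion.

The transport `SendsQ`/`sendToQ`, the diagonal action `pairActQ` on `BondConfig V × UnitAddCircle`,
invariance and measurability are the tree's, verbatim with `OnePartitionRelQ`; "`C ∩ L₀` is
infinite" is `ae_infinite_branchSet_inter_classQ` (Fubini over `θ` and the quasi-transitive
Lemma 5.2 for branches, `ae_infinite_branchSet_inter_weightSlab'`); the MTP contradiction is the
quasi-transitive one, `measure_eq_zero_of_infinite_senders_quasiTransitive`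
(`TimarMassTransportQuasiTransitive.lean`: summed over orbit representatives, then invariance).
Main result: `ae_exists_isEncounter_of_branch_quasiTransitive`.

## References

* Á. Timár, Ann. Probab. 34 (2006) 2344–2364 (arXiv:math/0702875), §5, Lemma 5.3 and its proof;
  Lemma 2.2. [Timar2006]
* R. Lyons, Y. Peres, *Probability on Trees and Networks*, CUP 2016, §8.2 ((8.10), Cor. 8.11).
  [LyonsPeres2016]
* T. Hutchcroft, C. R. Math. Acad. Sci. Paris 354 (2016) 944–947, §2 (quasi-transitive setting).
  [Hutchcroft2016]
-/

noncomputable section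

namespace Literature.Barriers.CriticalPhenomena

open _root_.MeasureTheory _root_.Filter Literature.Probability.Percolation SimpleGraph
open scoped _root_.ENNReal _root_.Topology

variable {V : Type*} {G : SimpleGraph V} [G.LocallyFinite]

/-! ### The transport and the uniqueness of the receiver -/

/-- **`y` sends unit mass to `x`**: `x` is an encounter point in the class of `y`, and `y` lies in
a heavy branch at `x` — the branch of a vertex `u` of the cluster of `x` — that contains no
encounter point of the class of `x` ("let each vertex `y` contained in such a `C ∩ L₀` send mass `1`
to `x`"). [cite: Timar2006, Lemma 5.3 (proof: the mass transport)] -/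
def SendsQ (G : SimpleGraph V) [G.LocallyFinite] (o : V) (ω : BondConfig V) (θ : UnitAddCircle)
    (y x : V) : Prop :=
  IsEncounter G o ω x ∧ OnePartitionRelQ G o θ x y ∧
    ∃ u ∈ openCluster ω x, y ∈ branchSet ω x u ∧ IsHeavy G o (branchSet ω x u) ∧
      ∀ z ∈ branchSet ω x u, OnePartitionRelQ G o θ x z → ¬ IsEncounter G o ω z

variable {o : V}

/-- A receiver `x'` other than `x` is not in the branch through `y` at `x`. [folklore] -/
theorem SendsQ.not_avoidReach {ω : BondConfig V} {θ : UnitAddCircle} {y x x' : V}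
    (h : SendsQ G o ω θ y x) (h' : SendsQ G o ω θ y x') :
    ¬ AvoidReach (openGraph ω) x y x' := by
  intro hyx'
  obtain ⟨u, -, hyu, -, hno⟩ := h.2.2
  have hE := onePartitionRelQ_equivalence G o θ
  -- `x'` is in the branch of `y` at `x`, in the class of `x`, and an encounter point
  exact hno x' (hyu.trans hyx') (hE.trans h.2.1 (hE.symm h'.2.1)) h'.1

/-- **The receiver is unique** ("send mass `1` to `x` … where there is an `x`–`y` path in `ω`
that does not contain any other encounter point inside `L₀`": there is at most one such `x`).
[cite: Timar2006, Lemma 5.3 (proof: expected mass sent out is at most 1)] -/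
theorem SendsQ.unique {ω : BondConfig V} {θ : UnitAddCircle} {y x x' : V}
    (h : SendsQ G o ω θ y x) (h' : SendsQ G o ω θ y x') : x = x' := by
  classical
  by_contra hne
  have h1 : ¬ AvoidReach (openGraph ω) x y x' := h.not_avoidReach h'
  have h2 : ¬ AvoidReach (openGraph ω) x' y x := h'.not_avoidReach h
  -- `y` is joined to `x` (it lies in a branch of a vertex of `C(x)`)
  obtain ⟨u, hu, hyu, -, -⟩ := h.2.2
  have hyx : (openGraph ω).Reachable y x :=
    (hyu.reachable.symm).trans (show (openGraph ω).Reachable u x from Reachable.symm hu)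
  obtain ⟨q⟩ := hyx
  set p := q.bypass with hp
  have hpath : p.IsPath := q.bypass_isPath
  -- a path from `y` to `x` avoiding `x'` would contradict `h2`; so it passes `x'` …
  by_cases hx' : x' ∈ p.support
  · -- … and its initial segment to `x'` avoids `x`, contradicting `h1`
    have hxne : x ≠ x' := hne
    exact h1 ⟨p.takeUntil x' hx', Walk.endpoint_notMem_support_takeUntil hpath hx' hxne⟩
  · exact h2 ⟨p, hx'⟩

/-! ### The point allocation -/

open Classical in
/-- **The point allocation of the proof of Lemma 5.3**: `y ↦` its unique receiver, if any.
[cite: Timar2006, Lemma 5.3 (proof: the mass transport)] -/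
def sendToQ (G : SimpleGraph V) [G.LocallyFinite] (o : V) (q : BondConfig V × UnitAddCircle) (y : V) :
    Option V :=
  if h : ∃ x, SendsQ G o q.1 q.2 y x then some h.choose else none

/-- `sendToQ y = some x ↔ SendsQ y x` (uniqueness of the receiver). [folklore] -/
theorem sendToQ_eq_some_iff {q : BondConfig V × UnitAddCircle} {y x : V} :
    sendToQ G o q y = some x ↔ SendsQ G o q.1 q.2 y x := by
  classical
  unfold sendToQ
  split_ifs with h
  · rw [Option.some.injEq]
    exact ⟨fun hx => hx ▸ h.choose_spec, fun hx => h.choose_spec.unique hx⟩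
  · simp only [false_iff]
    exact fun hx => h ⟨x, hx⟩

/-! ### The action of `Aut(G)` on `(ω, θ)` -/

section Action

variable (G) (o)

/-- The diagonal action on `(ω, θ)`. [cite: Timar2006, §5 (invariance of the 1-partition)] -/
def pairActQ (γ : G ≃g G) (q : BondConfig V × UnitAddCircle) : BondConfig V × UnitAddCircle :=
  (BondConfig.relabel (sym2Equiv γ.toEquiv) q.1, onePartitionActQ G o γ q.2)

/-- The action is measurable … [folklore] -/
theorem measurable_pairActQ (γ : G ≃g G) : Measurable (pairActQ G o γ) :=
  (BondConfig.relabel (sym2Equiv γ.toEquiv)).measurable.prodMap (measurable_onePartitionActQ γ)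

/-- … and preserves `P_p ⊗ Haar`. [cite: Timar2006, §5 (invariance of the 1-partition)] -/
theorem map_pairActQ [Countable V] (p : unitInterval) (γ : G ≃g G) :
    ((bondPercolation G p).prod (volume : Measure UnitAddCircle)).map (pairActQ G o γ) =
      (bondPercolation G p).prod (volume : Measure UnitAddCircle) :=
  (MeasurePreserving.prod ⟨(BondConfig.relabel (sym2Equiv γ.toEquiv)).measurable,
    bondPercolation_map_relabel_iso γ p⟩ (measurePreserving_onePartitionActQ γ)).map_eq

variable {G o}

/-- `SendsQ` is transported by the action. [cite: Timar2006, Lemma 5.3 (proof: invariance of the transport)] -/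
theorem sendsQ_pairActQ_iff (hconn : G.Connected) (γ : G ≃g G) (q : BondConfig V × UnitAddCircle)
    (y x : V) : SendsQ G o (pairActQ G o γ q).1 (pairActQ G o γ q).2 (γ y) (γ x) ↔ SendsQ G o q.1 q.2 y x := by
  have hC : openCluster (BondConfig.relabel (sym2Equiv γ.toEquiv) q.1) (γ x) =
      (γ : V → V) '' openCluster q.1 x := openCluster_relabel γ.toEquiv q.1 x
  have hB : ∀ u, branchSet (BondConfig.relabel (sym2Equiv γ.toEquiv) q.1) (γ x) (γ u) =
      (γ : V → V) '' branchSet q.1 x u := fun u => branchSet_relabel γ.toEquiv q.1 x u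
  simp only [SendsQ, pairActQ]
  rw [isEncounter_relabel_iff G hconn γ o, onePartitionRelQ_act_iff hconn, hC]
  refine and_congr_right fun _ => and_congr_right fun _ => ⟨?_, ?_⟩
  · rintro ⟨u', ⟨u, hu, rfl⟩, hy, hH, hno⟩
    rw [hB u, γ.injective.mem_set_image] at hy
    rw [hB u, isHeavy_image_iff G hconn γ o] at hH
    refine ⟨u, hu, hy, hH, fun z hz hR hE => hno (γ z) ?_ ?_ ?_⟩
    · rw [hB u]; exact ⟨z, hz, rfl⟩
    · exact (onePartitionRelQ_act_iff hconn γ q.2 x z).2 hR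
    · exact (isEncounter_relabel_iff G hconn γ o q.1 z).2 hE
  · rintro ⟨u, hu, hy, hH, hno⟩
    refine ⟨γ u, ⟨u, hu, rfl⟩, ?_, ?_, ?_⟩
    · rw [hB u, γ.injective.mem_set_image]; exact hy
    · rw [hB u, isHeavy_image_iff G hconn γ o]; exact hH
    · rintro _ hz' hR hE
      rw [hB u] at hz'
      obtain ⟨z, hz, rfl⟩ := hz'
      exact hno z hz ((onePartitionRelQ_act_iff hconn γ q.2 x z).1 hR)
        ((isEncounter_relabel_iff G hconn γ o q.1 z).1 hE)

/-- The point allocation is equivariant. [folklore] -/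
theorem sendToQ_pairActQ (hconn : G.Connected) (γ : G ≃g G) (q : BondConfig V × UnitAddCircle) (y : V) :
    sendToQ G o (pairActQ G o γ q) (γ y) = (sendToQ G o q y).map γ := by
  cases h : sendToQ G o q y with
  | none =>
    rw [Option.map_none]
    cases h' : sendToQ G o (pairActQ G o γ q) (γ y) with
    | none => rfl
    | some x' =>
      exfalso
      have hs := sendToQ_eq_some_iff.1 h'
      rw [← γ.apply_symm_apply x'] at hs
      have := (sendsQ_pairActQ_iff hconn γ q y (γ.symm x')).1 hs
      rw [← sendToQ_eq_some_iff] at this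
      rw [h] at this
      exact Option.some_ne_none _ this.symm
  | some x =>
    rw [Option.map_some]
    exact sendToQ_eq_some_iff.2 ((sendsQ_pairActQ_iff hconn γ q y x).2 (sendToQ_eq_some_iff.1 h))

end Action

/-! ### Measurability -/

section Measurable

variable [Countable V]

/-- `{SendsQ y x}` is measurable in `(ω, θ)`. [folklore] -/
theorem measurableSet_sendsQ (o y x : V) :
    MeasurableSet {q : BondConfig V × UnitAddCircle | SendsQ G o q.1 q.2 y x} := by
  have h : {q : BondConfig V × UnitAddCircle | SendsQ G o q.1 q.2 y x} =
      (Prod.fst ⁻¹' {ω | IsEncounter G o ω x}) ∩ ((Prod.snd ⁻¹' {θ | OnePartitionRelQ G o θ x y}) ∩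
        ⋃ u, ((Prod.fst ⁻¹' {ω | (openGraph ω).Reachable x u}) ∩ ((Prod.fst ⁻¹' {ω | y ∈ branchSet ω x u}) ∩
          ((Prod.fst ⁻¹' {ω | IsHeavy G o (branchSet ω x u)}) ∩
            ⋂ z, ((Prod.fst ⁻¹' {ω | z ∈ branchSet ω x u})ᶜ ∪ ((Prod.snd ⁻¹' {θ | OnePartitionRelQ G o θ x z})ᶜ ∪
              (Prod.fst ⁻¹' {ω | IsEncounter G o ω z})ᶜ)))))) := by
    ext q
    simp only [SendsQ, Set.mem_setOf_eq, Set.mem_inter_iff, Set.mem_preimage, Set.mem_iUnion,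
      Set.mem_iInter, Set.mem_union, Set.mem_compl_iff]
    refine and_congr_right fun _ => and_congr_right fun _ => exists_congr fun u => ?_
    refine and_congr_right fun _ => and_congr_right fun _ => and_congr_right fun _ => ?_
    refine forall_congr' fun z => ⟨fun h' => ?_, fun h' hz hR hE => ?_⟩
    · by_cases hz : z ∈ branchSet q.1 x u
      · by_cases hR : OnePartitionRelQ G o q.2 x z
        · exact Or.inr (Or.inr (h' hz hR))
        · exact Or.inr (Or.inl hR)
      · exact Or.inl hz
    · rcases h' with h' | h' | h'
      · exact absurd hz h'
      · exact absurd hR h'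
      · exact h' hE
  rw [h]
  refine ((measurableSet_isEncounter G o x).preimage measurable_fst).inter
    (((measurableSet_setOf_onePartitionRelQ x y).preimage measurable_snd).inter
      (MeasurableSet.iUnion fun u => ?_))
  refine ((measurableSet_setOf_reachable x u).preimage measurable_fst).inter
    (((measurableSet_mem_branchSet x u y).preimage measurable_fst).inter
      (((measurableSet_isHeavy_branchSet G o x u).preimage measurable_fst).inter
        (MeasurableSet.iInter fun z => ?_)))
  exact ((measurableSet_mem_branchSet x u z).preimage measurable_fst).compl.union
    ((((measurableSet_setOf_onePartitionRelQ x z).preimage measurable_snd).compl).union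
      ((measurableSet_isEncounter G o z).preimage measurable_fst).compl)

/-- The fibres of the allocation are measurable. [folklore] -/
theorem measurableSet_sendToQ_eq_some (o y x : V) :
    MeasurableSet {q : BondConfig V × UnitAddCircle | sendToQ G o q y = some x} := by
  simp_rw [sendToQ_eq_some_iff]
  exact measurableSet_sendsQ o y x

/-- The event "some heavy branch meets the class of its base vertex in finitely many vertices" is
measurable in `(ω, θ)`. [folklore] -/
theorem measurableSet_finite_branchSet_inter_classQ (o x u : V) :
    MeasurableSet {q : BondConfig V × UnitAddCircle |
      (branchSet q.1 x u ∩ {z | OnePartitionRelQ G o q.2 x z}).Finite} := by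
  have henc : Measurable fun q : BondConfig V × UnitAddCircle =>
      ((branchSet q.1 x u ∩ {z | OnePartitionRelQ G o q.2 x z}).encard : ENNReal) := by
    have h : ∀ q : BondConfig V × UnitAddCircle,
        ((branchSet q.1 x u ∩ {z | OnePartitionRelQ G o q.2 x z}).encard : ENNReal) =
          ∑' z, ({q' : BondConfig V × UnitAddCircle | z ∈ branchSet q'.1 x u} ∩
            {q' | OnePartitionRelQ G o q'.2 x z}).indicator 1 q := by
      intro q
      rw [show (((branchSet q.1 x u ∩ {z | OnePartitionRelQ G o q.2 x z}).encard : ENNReal)) =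
          ∑' z, (branchSet q.1 x u ∩ {z | OnePartitionRelQ G o q.2 x z}).indicator 1 z by
        rw [show (1 : V → ENNReal) = fun _ => 1 from rfl, tsum_indicator_const, mul_one]]
      refine tsum_congr fun z => ?_
      by_cases hz : z ∈ branchSet q.1 x u ∩ {z | OnePartitionRelQ G o q.2 x z}
      · rw [Set.indicator_of_mem hz, Set.indicator_of_mem
          (show q ∈ {q' : BondConfig V × UnitAddCircle | z ∈ branchSet q'.1 x u} ∩
            {q' | OnePartitionRelQ G o q'.2 x z} from hz)]
        rfl
      · rw [Set.indicator_of_notMem hz, Set.indicator_of_notMem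
          (show q ∉ {q' : BondConfig V × UnitAddCircle | z ∈ branchSet q'.1 x u} ∩
            {q' | OnePartitionRelQ G o q'.2 x z} from hz)]
    simp_rw [h]
    refine measurable_tsum_ennreal fun z => measurable_one.indicator ?_
    exact ((measurableSet_mem_branchSet x u z).preimage measurable_fst).inter
      ((measurableSet_setOf_onePartitionRelQ x z).preimage measurable_snd)
  have h : {q : BondConfig V × UnitAddCircle |
      (branchSet q.1 x u ∩ {z | OnePartitionRelQ G o q.2 x z}).Finite} =
      {q | ((branchSet q.1 x u ∩ {z | OnePartitionRelQ G o q.2 x z}).encard : ENNReal) < ⊤} := by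
    ext q
    simp only [Set.mem_setOf_eq]
    rw [ENat.toENNReal_lt_top, ← Set.encard_lt_top_iff]
  rw [h]
  exact measurableSet_lt henc measurable_const

/-- The violating event at `x` ("`C ∩ L₀` does not contain any encounter points" for a heavy
branch `C` at the encounter point `x`) is measurable. [folklore] -/
theorem measurableSet_badBranchQ (o x : V) :
    MeasurableSet {q : BondConfig V × UnitAddCircle | IsEncounter G o q.1 x ∧
      ∃ u ∈ openCluster q.1 x, IsHeavy G o (branchSet q.1 x u) ∧
        ∀ z ∈ branchSet q.1 x u, OnePartitionRelQ G o q.2 x z → ¬ IsEncounter G o q.1 z} := by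
  have h : {q : BondConfig V × UnitAddCircle | IsEncounter G o q.1 x ∧
      ∃ u ∈ openCluster q.1 x, IsHeavy G o (branchSet q.1 x u) ∧
        ∀ z ∈ branchSet q.1 x u, OnePartitionRelQ G o q.2 x z → ¬ IsEncounter G o q.1 z} =
      (Prod.fst ⁻¹' {ω | IsEncounter G o ω x}) ∩
        ⋃ u, ((Prod.fst ⁻¹' {ω | (openGraph ω).Reachable x u}) ∩
          ((Prod.fst ⁻¹' {ω | IsHeavy G o (branchSet ω x u)}) ∩
            ⋂ z, ((Prod.fst ⁻¹' {ω | z ∈ branchSet ω x u})ᶜ ∪ ((Prod.snd ⁻¹' {θ | OnePartitionRelQ G o θ x z})ᶜ ∪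
              (Prod.fst ⁻¹' {ω | IsEncounter G o ω z})ᶜ)))) := by
    ext q
    simp only [Set.mem_setOf_eq, Set.mem_inter_iff, Set.mem_preimage, Set.mem_iUnion,
      Set.mem_iInter, Set.mem_union, Set.mem_compl_iff]
    refine and_congr_right fun _ => exists_congr fun u => ?_
    refine and_congr_right fun _ => and_congr_right fun _ => ?_
    refine forall_congr' fun z => ⟨fun h' => ?_, fun h' hz hR hE => ?_⟩
    · by_cases hz : z ∈ branchSet q.1 x u
      · by_cases hR : OnePartitionRelQ G o q.2 x z
        · exact Or.inr (Or.inr (h' hz hR))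
        · exact Or.inr (Or.inl hR)
      · exact Or.inl hz
    · rcases h' with h' | h' | h'
      · exact absurd hz h'
      · exact absurd hR h'
      · exact h' hE
  rw [h]
  refine ((measurableSet_isEncounter G o x).preimage measurable_fst).inter (MeasurableSet.iUnion fun u => ?_)
  refine ((measurableSet_setOf_reachable x u).preimage measurable_fst).inter
    (((measurableSet_isHeavy_branchSet G o x u).preimage measurable_fst).inter
      (MeasurableSet.iInter fun z => ?_))
  exact ((measurableSet_mem_branchSet x u z).preimage measurable_fst).compl.union
    ((((measurableSet_setOf_onePartitionRelQ x z).preimage measurable_snd).compl).union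
      ((measurableSet_isEncounter G o z).preimage measurable_fst).compl)

end Measurable

/-! ### `C ∩ L₀` is infinite, jointly in `(ω, θ)` -/

section Probabilistic

variable [Countable V]

/-- **"`C ∩ L₀` is infinite (by deletion tolerance and Lemma 5.2)"**, jointly in `(ω, θ)`:
almost surely for `P_p ⊗ Haar`, every heavy branch at every vertex `x` meets the class of `x` in
the 1-partition in infinitely many vertices (Fubini: for fixed `θ` a class is a fixed slab of
width `μ`, `setOf_onePartitionRel_eq_weightSlab`, and `ae_infinite_branchSet_inter_weightSlab`
applies). [cite: Timar2006, Lemma 5.3 (proof: "C ∩ L₀ is infinite")] -/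
theorem ae_infinite_branchSet_inter_classQ (hconn : G.Connected) (hqt : IsQuasiTransitive G)
    (hU : ¬ IsGraphUnimodular G) {p : unitInterval} (hp0 : 0 < (p : ℝ)) (hp1 : (p : ℝ) < 1) (o : V) :
    ∀ᵐ q ∂((bondPercolation G p).prod (volume : Measure UnitAddCircle)), ∀ x u,
      IsHeavy G o (branchSet q.1 x u) →
        (branchSet q.1 x u ∩ {z | OnePartitionRelQ G o q.2 x z}).Infinite := by
  set μ₂ := (bondPercolation G p).prod (volume : Measure UnitAddCircle) with hμ₂
  set N : Set (BondConfig V × UnitAddCircle) := {q | ∃ x u, IsHeavy G o (branchSet q.1 x u) ∧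
      (branchSet q.1 x u ∩ {z | OnePartitionRelQ G o q.2 x z}).Finite} with hN
  have hNm : MeasurableSet N := by
    have h : N = ⋃ x, ⋃ u, ((Prod.fst ⁻¹' {ω | IsHeavy G o (branchSet ω x u)}) ∩
        {q | (branchSet q.1 x u ∩ {z | OnePartitionRelQ G o q.2 x z}).Finite}) := by
      ext q; simp only [hN, Set.mem_setOf_eq, Set.mem_iUnion, Set.mem_inter_iff, Set.mem_preimage]
    rw [h]
    exact MeasurableSet.iUnion fun x => MeasurableSet.iUnion fun u =>
      ((measurableSet_isHeavy_branchSet G o x u).preimage measurable_fst).inter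
        (measurableSet_finite_branchSet_inter_classQ o x u)
  have hN0 : μ₂ N = 0 := by
    rw [hμ₂, Measure.prod_apply_symm hNm]
    have hsec : ∀ θ : UnitAddCircle, bondPercolation G p ((fun ω => (ω, θ)) ⁻¹' N) = 0 := by
      intro θ
      have hcov : (fun ω => (ω, θ)) ⁻¹' N ⊆ ⋃ x, {ω : BondConfig V | ∃ u, IsHeavy G o (branchSet ω x u) ∧
          (branchSet ω x u ∩ weightSlab G o (minEdgeRatio G * oneClassTopQ G θ (oneIndexQ G o θ x))
            (oneClassTopQ G θ (oneIndexQ G o θ x))).Finite} := by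
        rintro ω ⟨x, u, hH, hfin⟩
        refine Set.mem_iUnion.2 ⟨x, u, hH, ?_⟩
        rw [← setOf_onePartitionRelQ_eq_weightSlab hconn hqt hU θ x]
        exact hfin
      refine measure_mono_null hcov (measure_iUnion_null fun x => ?_)
      refine measure_mono_null ?_ (ae_iff.1 (ae_infinite_branchSet_inter_weightSlab' hconn hqt hU hp0 hp1 o
        (le_refl (minEdgeRatio G * oneClassTopQ G θ (oneIndexQ G o θ x)))
        (oneClassTopQ_ne_zero hconn hqt hU θ _) (oneClassTopQ_ne_top θ _)))
      rintro ω ⟨u, hH, hfin⟩ hall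
      exact hfin.not_infinite (hall x u hH)
    simp only [hsec, lintegral_zero]
  filter_upwards [measure_eq_zero_iff_ae_notMem.1 hN0] with q hq x u hH
  by_contra hfin
  exact hq ⟨x, u, hH, Set.not_infinite.1 hfin⟩

omit [Countable V] in
/-- The violating event at `x` is invariant under the diagonal action. [cite: Timar2006, Lemma 5.3 (proof: invariance)] -/
theorem preimage_pairActQ_badBranch (hconn : G.Connected) (o : V) (γ : G ≃g G) (x : V) :
    pairActQ G o γ ⁻¹' {q : BondConfig V × UnitAddCircle | IsEncounter G o q.1 (γ x) ∧
      ∃ u ∈ openCluster q.1 (γ x), IsHeavy G o (branchSet q.1 (γ x) u) ∧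
        ∀ z ∈ branchSet q.1 (γ x) u, OnePartitionRelQ G o q.2 (γ x) z → ¬ IsEncounter G o q.1 z} =
    {q | IsEncounter G o q.1 x ∧ ∃ u ∈ openCluster q.1 x, IsHeavy G o (branchSet q.1 x u) ∧
        ∀ z ∈ branchSet q.1 x u, OnePartitionRelQ G o q.2 x z → ¬ IsEncounter G o q.1 z} := by
  ext q
  have hC : openCluster (BondConfig.relabel (sym2Equiv γ.toEquiv) q.1) (γ x) =
      (γ : V → V) '' openCluster q.1 x := openCluster_relabel γ.toEquiv q.1 x
  have hB : ∀ u, branchSet (BondConfig.relabel (sym2Equiv γ.toEquiv) q.1) (γ x) (γ u) =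
      (γ : V → V) '' branchSet q.1 x u := fun u => branchSet_relabel γ.toEquiv q.1 x u
  simp only [Set.mem_preimage, Set.mem_setOf_eq, pairActQ]
  rw [isEncounter_relabel_iff G hconn γ o, hC]
  refine and_congr_right fun _ => ⟨?_, ?_⟩
  · rintro ⟨u', ⟨u, hu, rfl⟩, hH, hno⟩
    rw [hB u, isHeavy_image_iff G hconn γ o] at hH
    refine ⟨u, hu, hH, fun z hz hR hE => hno (γ z) ?_ ?_ ?_⟩
    · rw [hB u]; exact ⟨z, hz, rfl⟩
    · exact (onePartitionRelQ_act_iff hconn γ q.2 x z).2 hR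
    · exact (isEncounter_relabel_iff G hconn γ o q.1 z).2 hE
  · rintro ⟨u, hu, hH, hno⟩
    refine ⟨γ u, ⟨u, hu, rfl⟩, ?_, ?_⟩
    · rw [hB u, isHeavy_image_iff G hconn γ o]; exact hH
    · rintro _ hz' hR hE
      rw [hB u] at hz'
      obtain ⟨z, hz, rfl⟩ := hz'
      exact hno z hz ((onePartitionRelQ_act_iff hconn γ q.2 x z).1 hR)
        ((isEncounter_relabel_iff G hconn γ o q.1 z).1 hE)

/-- **Timár 2006, Lemma 5.3, second part, PROVED on quasi-transitive graphs.** On a connected,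
locally finite, quasi-transitive, nonunimodular graph, for `0 < p < 1`, almost surely for
`P_p ⊗ Haar` (percolation and the quasi-transitive 1-partition): for every encounter point `x`,
every vertex `u` of the cluster of `x` whose branch at `x` is heavy, the branch contains an
encounter point of the class of `x`. Proof as printed, the MTP contradiction in its
quasi-transitive form (`measure_eq_zero_of_infinite_senders_quasiTransitive`): on the violating
event, the infinitely many vertices of `C ∩ L₀` (weights `> δ b` on the class `(δ b, b]` of `x`)
all send their unit mass to `x`. [cite: Timar2006, Lemma 5.3 (second part) and its proof] [cite: Hutchcroft2016, §2] -/
theorem ae_exists_isEncounter_of_branch_quasiTransitive (hconn : G.Connected) (hqt : IsQuasiTransitive G)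
    (hU : ¬ IsGraphUnimodular G) {p : unitInterval} (hp0 : 0 < (p : ℝ)) (hp1 : (p : ℝ) < 1) (o : V) :
    ∀ᵐ q ∂((bondPercolation G p).prod (volume : Measure UnitAddCircle)), ∀ x,
      IsEncounter G o q.1 x → ∀ u ∈ openCluster q.1 x, IsHeavy G o (branchSet q.1 x u) →
        ∃ z ∈ branchSet q.1 x u, IsEncounter G o q.1 z ∧ OnePartitionRelQ G o q.2 x z := by
  classical
  set μ₂ := (bondPercolation G p).prod (volume : Measure UnitAddCircle) with hμ₂
  set Bad : V → Set (BondConfig V × UnitAddCircle) := fun x => {q | IsEncounter G o q.1 x ∧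
      ∃ u ∈ openCluster q.1 x, IsHeavy G o (branchSet q.1 x u) ∧
        ∀ z ∈ branchSet q.1 x u, OnePartitionRelQ G o q.2 x z → ¬ IsEncounter G o q.1 z} with hBad
  have hnull : ∀ x, μ₂ (Bad x) = 0 := by
    refine measure_eq_zero_of_infinite_senders_quasiTransitive hconn hqt μ₂ (pairActQ G o)
      (measurable_pairActQ G o) (map_pairActQ G o p) (τ := sendToQ G o)
      (fun y x => measurableSet_sendToQ_eq_some o y x) (sendToQ_pairActQ hconn) o Bad
      (fun x => measurableSet_badBranchQ o x) (fun γ x => preimage_pairActQ_badBranch hconn o γ x) ?_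
    intro x
    filter_upwards [ae_infinite_branchSet_inter_classQ hconn hqt hU hp0 hp1 o] with q hA hq
    obtain ⟨hxE, u, hu, hH, hno⟩ := hq
    obtain ⟨b, hb0, -, hslab⟩ := exists_setOf_onePartitionRelQ_eq_weightSlab (o := o) hconn hqt hU q.2 x
    refine ⟨minEdgeRatio G * b, mul_ne_zero (minEdgeRatio_ne_zero hconn hqt) hb0, ?_⟩
    set S := branchSet q.1 x u ∩ {z | OnePartitionRelQ G o q.2 x z} with hS
    have hSinf : S.Infinite := hA x u hH
    refine hSinf.mono ?_
    rintro y ⟨hyB, hyR⟩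
    refine ⟨sendToQ_eq_some_iff.2 ⟨hxE, hyR, u, hu, hyB, hH, hno⟩, ?_⟩
    have : y ∈ weightSlab G o (minEdgeRatio G * b) b := by
      rw [← hslab]; exact hyR
    exact this.1.le
  have hae : ∀ᵐ q ∂μ₂, ∀ x, q ∉ Bad x := by
    rw [ae_all_iff]; intro x
    exact measure_eq_zero_iff_ae_notMem.1 (hnull x)
  filter_upwards [hae] with q hq x hxE u hu hH
  by_contra hno
  push Not at hno
  exact hq x ⟨hxE, u, hu, hH, fun z hz hR hE => hno z hz hE hR⟩

end Probabilistic

end Literature.Barriers.CriticalPhenomena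

end
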